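import Summits.HodgeConjecture.HodgeConjecture.Theorems.MarkmanPartnerTransportPicardThreeK3SquaresRealMultiplicationRanks

/-!
# Route MarkmanPartnerTransport · crux `PicardThreeK3Squares` (stmt-HodgeConjecture-19652) —
# consequences of the real-multiplication rank constraint `22 - ρ(S) = e · m` (`e ≥ 2`, `m ≥ 3`)

Sequel to `Theorems/…RealMultiplicationRanks`
(`scalar_or_hasComplexMultiplication_of_forall_mul_add_ne`: off those ranks `End_Hdg(T(S)) = ℚ` or
`S` is CM, granted markings):

* `hodgeConjectureFor_square_of_forall_mul_add_ne` — HC for `S × S` modulo Buskin's Thm. 1.1 and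
  markings for every projective K3 surface with `e · m + ρ(S) ≠ 22` for all `e ≥ 2`, `m ≥ 3`;
* `hodgeConjectureFor_square_of_picard_mem` — in particular for `ρ(S) ∈ {3, 5, 9, 11, 15, 17, 18, 19, 20}`
  (`22 - ρ` prime or `≤ 5`; `mul_add_ne_of_lt_six_or_prime`);
* `picardThreeK3Squares_of_realMultiplicationRanks` — the crux `PicardThreeK3Squares` reduced (mod
  Buskin Thm. 1.1 + markings) to the cycle-induced sector clause on non-CM, non-scalar projective K3
  surfaces with `ρ(S) ≥ 3` and `22 - ρ(S) = e · m` for some `e ≥ 2`, `m ≥ 3`, i.e.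
  `ρ(S) ∈ {4, 6, 7, 8, 10, 12, 13, 14, 16}` — the real-multiplication ranks (van Geemen–Schütt 2025
  §2.1, Table: `d = 22 - ρ ∈ {6, 8, 9, 10, 12, 14, 15, 16, 18}`).

No definition, no sorry; named facts only as hypotheses. Prover seat hodge-nonav-19652-p1 (gen 0),
`--supports stmt-HodgeConjecture-19652`.

References: van Geemen, Michigan Math. J. 56 (2008), Lemma 3.2; van Geemen–Schütt, Forum Math. Sigma
13 (2025) e2, §2.1; Buskin, J. reine angew. Math. 755 (2019), Thm. 1.1; Varesco (2023), §2 p. 8.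
-/

set_option linter.dupNamespace false

noncomputable section

namespace Summit.HodgeConjecture.HodgeConjecture.Theorems.MarkmanPartnerTransport.RealMultiplicationRanks

open scoped Manifold
open Module CategoryTheory MonoidalCategory CartesianMonoidalCategory
open Literature.AlgebraicGeometry Literature.AlgebraicGeometry.Motives Literature.AlgebraicGeometry.HodgeTheory
open Literature.AlgebraicGeometry.Surfaces
open Literature.AlgebraicTopology.SingularHomology
open Summit.HodgeConjecture.HodgeConjecture.Theorems
open Summit.HodgeConjecture.HodgeConjecture.Theorems.NikulinTwinTransport

variable {S : SchemeOver ℂ}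

/-- `Corr[μ, hS ; γ, y] = pr₁_*(pr₂^* y ∪ γ)` on `H²(S(ℂ); ℂ)`. Local notation only. -/
local notation3 (prettyPrint := false) "Corr[" μ ", " hS " ; " γ ", " y "]" =>
  complexGysin μ (IsSmoothProjective.tensor_holds hS hS) hS
    (SemiCartesianMonoidalCategory.fst _ _) (rfl : 2 * 1 + 2 * 2 + 2 * 2 = 2 * 1 + 2 * (2 + 2))
    (cupProduct (rfl : 2 * 1 + 2 * 2 = 2 * 1 + 2 * 2)
      (complexBetti.map (SemiCartesianMonoidalCategory.snd _ _) (2 * 1) y) γ)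

/-! ### The Hodge conjecture for `S × S` off the real-multiplication ranks -/

/-- **HC for `S ⊗ S` modulo Buskin's Thm. 1.1 and markings, for every projective K3 surface whose
transcendental rank `22 - ρ(S)` is not a product `e · m`, `e ≥ 2`, `m ≥ 3`** (no real multiplication:
`E = ℚ` by `hodgeConjectureFor_square_of_hodgeEndomorphisms_scalar`, or CM by
`CMThird.hodgeConjectureFor_square_of_CM_of_buskin`). [cite: Vangeemen2008, Lemma 3.2]
[cite: Buskin2019, Thm. 1.1 and Corollary] -/
theorem hodgeConjectureFor_square_of_forall_mul_add_ne (hB : Buskin2019_hodgeIsometry_algebraic)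
    (hmark : Huybrechts_K3_marking_exists) (hS : IsK3Surface S)
    (hρ : ∀ e m : ℕ, 2 ≤ e → 3 ≤ m → e * m + Module.finrank ℂ ↥(algebraicClasses S 1) ≠ 22) :
    HodgeConjectureFor 4 (S ⊗ S) := by
  rcases scalar_or_hasComplexMultiplication_of_forall_mul_add_ne hmark hS hρ with hQ | hCM
  · exact SquareGlueFree.hodgeConjectureFor_square_of_hodgeEndomorphisms_scalar hS.isSmoothProjective hQ
  · exact CMThird.hodgeConjectureFor_square_of_CM_of_buskin hB hmark S hS hCM

/-- A product `e · m` with `e ≥ 2`, `m ≥ 3` is neither `< 6` nor a prime. [folklore] -/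
theorem mul_add_ne_of_lt_six_or_prime {e m ρ : ℕ} (he : 2 ≤ e) (hm : 3 ≤ m)
    (h : 22 - ρ < 6 ∨ (22 - ρ).Prime) (hρ22 : ρ ≤ 22) : e * m + ρ ≠ 22 := by
  intro hsum
  have hem : e * m = 22 - ρ := by omega
  have h6 : 6 ≤ e * m := by nlinarith
  rcases h with hlt | hp
  · omega
  · rw [← hem] at hp
    rcases hp.eq_one_or_self_of_dvd e (Dvd.intro m rfl) with h1 | h2
    · omega
    · nlinarith

/-- **HC for `S ⊗ S`, modulo Buskin's Thm. 1.1 and markings, at the Picard numbers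
`ρ(S) ∈ {3, 5, 9, 11, 15, 17, 18, 19, 20}`** — those `ρ ≥ 3` at which a projective K3 surface cannot
have real multiplication (`22 - ρ` prime or `≤ 5`). The complementary list `{4,6,7,8,10,12,13,14,16}`
is where the crux `PicardThreeK3Squares` is open. [cite: Vangeemen2008, Lemma 3.2]
[cite: GeemenSchutt2023, §2.1] [cite: Buskin2019, Thm. 1.1] -/
theorem hodgeConjectureFor_square_of_picard_mem (hB : Buskin2019_hodgeIsometry_algebraic)
    (hmark : Huybrechts_K3_marking_exists) (hS : IsK3Surface S)
    (hρ : Module.finrank ℂ ↥(algebraicClasses S 1) ∈ ({3, 5, 9, 11, 15, 17, 18, 19, 20} : Finset ℕ)) :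
    HodgeConjectureFor 4 (S ⊗ S) := by
  refine hodgeConjectureFor_square_of_forall_mul_add_ne hB hmark hS fun e m he hm => ?_
  simp only [Finset.mem_insert, Finset.mem_singleton] at hρ
  rcases hρ with h | h | h | h | h | h | h | h | h <;> rw [h] <;>
    refine mul_add_ne_of_lt_six_or_prime he hm ?_ (by norm_num) <;> norm_num

/-! ### The crux reduced to the real-multiplication ranks -/

/-- **`PicardThreeK3Squares` from the cycle-induced sector clause on the REAL-MULTIPLICATION RANKS
only**, granted Buskin's Thm. 1.1 and markings: it suffices that for every projective K3 surface `S`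
with `ρ(S) ≥ 3`, `22 - ρ(S) = e · m` for some `e ≥ 2`, `m ≥ 3` (so `ρ(S) ∈ {4,6,7,8,10,12,13,14,16}`),
not CM and with `End_Hdg(T(S)) ≠ ℚ`, every rational Hodge endomorphism of `H²(S)` killing `N¹` with
image in `T` agrees on `T` with an `N¹`-stable endomorphism induced by an algebraic class on `S × S`.
Everything else is `hodgeConjectureFor_square_of_forall_mul_add_ne`, the CM third and the `E = ℚ`
third. [cite: Vangeemen2008, Lemma 3.2] [cite: Varesco2023, §2 (p. 8)] [cite: Buskin2019, Thm. 1.1] -/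
theorem picardThreeK3Squares_of_realMultiplicationRanks (hB : Buskin2019_hodgeIsometry_algebraic)
    (hmark : Huybrechts_K3_marking_exists)
    (hRM : ∀ (S : SchemeOver ℂ) (hS : IsK3Surface S), ¬ HasComplexMultiplication S →
      3 ≤ Module.finrank ℂ ↥(algebraicClasses S 1) →
      (∃ e m : ℕ, 2 ≤ e ∧ 3 ≤ m ∧ e * m + Module.finrank ℂ ↥(algebraicClasses S 1) = 22) →
      (¬ ∀ (f : complexBetti S (2 * 1) →ₗ[ℂ] complexBetti S (2 * 1)),
        (∀ y, IsRationalClass y → IsRationalClass (f y)) →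
        (∀ (i j : ℕ) y, IsOfHodgeType 2 S (2 * 1) i j y → IsOfHodgeType 2 S (2 * 1) i j (f y)) →
        (∀ d ∈ algebraicClasses S 1, f d = 0) →
        (∀ y : complexBetti S (2 * 1), ∀ d ∈ algebraicClasses S 1,
          cupProduct (rfl : 2 * 1 + 2 * 1 = 2 * 2) (f y) d = 0) →
        ∃ a : ℚ, ∀ y : complexBetti S (2 * 1),
          (∀ d ∈ algebraicClasses S 1, cupProduct (rfl : 2 * 1 + 2 * 1 = 2 * 2) y d = 0) →
            f y = (a : ℂ) • y) →
      ∀ (f : complexBetti S (2 * 1) →ₗ[ℂ] complexBetti S (2 * 1)),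
        (∀ y, IsRationalClass y → IsRationalClass (f y)) →
        (∀ (i j : ℕ) y, IsOfHodgeType 2 S (2 * 1) i j y → IsOfHodgeType 2 S (2 * 1) i j (f y)) →
        (∀ d ∈ algebraicClasses S 1, f d = 0) →
        (∀ y : complexBetti S (2 * 1), ∀ d ∈ algebraicClasses S 1,
          cupProduct (rfl : 2 * 1 + 2 * 1 = 2 * 2) (f y) d = 0) →
        ∃ g : complexBetti S (2 * 1) →ₗ[ℂ] complexBetti S (2 * 1),
          (∀ d ∈ algebraicClasses S 1, g d ∈ algebraicClasses S 1) ∧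
          (∃ γ ∈ algebraicClasses (S ⊗ S) 2, ∀ y : complexBetti S (2 * 1),
            g y = Corr[complexOrientationFamily, hS.isSmoothProjective ; γ, y]) ∧
          ∀ y : complexBetti S (2 * 1),
            (∀ d ∈ algebraicClasses S 1, cupProduct (rfl : 2 * 1 + 2 * 1 = 2 * 2) y d = 0) →
              f y = g y) :
    Summit.HodgeConjecture.HodgeConjecture.Theses.MarkmanPartnerTransport.PicardThreeK3Squares := by
  intro S hS η p x _ hρ
  by_cases hem : ∃ e m : ℕ, 2 ≤ e ∧ 3 ≤ m ∧ e * m + Module.finrank ℂ ↥(algebraicClasses S 1) = 22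
  swap
  · push Not at hem
    exact hodgeConjectureFor_square_of_forall_mul_add_ne hB hmark hS fun e m he hm => hem e m he hm
  by_cases hCM : HasComplexMultiplication S
  · exact CMThird.hodgeConjectureFor_square_of_CM_of_buskin hB hmark S hS hCM
  · by_cases hQ : ∀ (f : complexBetti S (2 * 1) →ₗ[ℂ] complexBetti S (2 * 1)),
        (∀ y, IsRationalClass y → IsRationalClass (f y)) →
        (∀ (i j : ℕ) y, IsOfHodgeType 2 S (2 * 1) i j y → IsOfHodgeType 2 S (2 * 1) i j (f y)) →
        (∀ d ∈ algebraicClasses S 1, f d = 0) →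
        (∀ y : complexBetti S (2 * 1), ∀ d ∈ algebraicClasses S 1,
          cupProduct (rfl : 2 * 1 + 2 * 1 = 2 * 2) (f y) d = 0) →
        ∃ a : ℚ, ∀ y : complexBetti S (2 * 1),
          (∀ d ∈ algebraicClasses S 1, cupProduct (rfl : 2 * 1 + 2 * 1 = 2 * 2) y d = 0) →
            f y = (a : ℂ) • y
    · exact SquareGlueFree.hodgeConjectureFor_square_of_hodgeEndomorphisms_scalar hS.isSmoothProjective hQ
    · exact CycleInducedSector.hodgeConjectureFor_square_of_cycleInducedSector complexOrientationFamily
        hS.isSmoothProjective (hRM S hS hCM hρ hem hQ)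

end Summit.HodgeConjecture.HodgeConjecture.Theorems.MarkmanPartnerTransport.RealMultiplicationRanks

end
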